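import Summits.CriticalPhenomena.Ising3DConformalLimit.Theorems.GapForcesFarMerging.Negative.SoftVerdicts

/-!
# `GapForcesFarMerging`: the line `rp-unpinch-single-passage` is soft except at quasi-multiplicativity, I
# (crux stmt-CriticalPhenomena-4468, route `EnergyNotSigmaSquared`; standing adversary, generation 3)

Part 1/4 — the lattice vocabulary of the registered skeleton
`Cruxes/GapForcesFarMerging/Lines/rp-unpinch-single-passage.lean` (`xR`, `up`, `dn`, `mirror`, `src`,
`Th`, copied verbatim), the ABSTRACT SHAPES of its five stub statements over a triple
(pair kernel `S`, two-point `T`, four-point `F`) — `RPUnpinchShape`, `RPUnpinchIsoShape` (the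
isosceles instances, the only ones the skeleton's glue `gapGivesSinglePinch` consumes),
`UnpinchedEnvelopeShape`, `SinglePinchLawShape`, `SinglePinchPositiveShape`,
`QuasiMultiplicativeShape` (with `pairCovS`, `TS`, `NparS`, `avoidS`) — the `Iff.rfl` certificates
that at `(cc2, criticalTwoPoint 3, criticalCorr 3 4)` they ARE the registered stubs, and FAMILY A′:
`θ_{A′} = θ_A · (1 − min(1,sep)·Pmin)` over the kernel `S₀`, with the soft package
(`softPackage_A'`), the GAP shape (`gapShape_A'`, via the stability lemma `gapShape_of_le_add`) and
no far merging (`not_farMergingShape_A'`). Parts 2–4: `LineFamily` (explicit values of A′ on the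
isosceles configurations), `LineVerdicts` (A′ has single-pinch law, strict positivity, envelope,
isosceles RP minors, and violates quasi-multiplicativity: `quasiMultiplicative_false_without_model`),
`ScaleIteration` (stub 5 is soft and PROVED: `scaleIteration_soft`, `scaleIteration_criticalCorr`,
`gapForcesFarMerging_of_four_stubs`).

## References

* M. Aizenman, Comm. Math. Phys. 86 (1982) 1–48, §§4–5 [AizenmanCMP1982].
* M. Aizenman, H. Duminil-Copin, Ann. Math. 194 (2021), §3 eqs. (3.7), (3.11)–(3.12), §5.1 eq. (5.3)
  [AizenmanDuminilCopinAnnals2021].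
* J. Fröhlich, R. Israel, E. H. Lieb, B. Simon, Comm. Math. Phys. 62 (1978) 1–34, Thm. 2.1 [FILS1978].
* G. F. Lawler, Intersections of Random Walks (1991), ch. 3–5 [Lawler1991].
-/

noncomputable section

namespace Summit.CriticalPhenomena.Ising3DConformalLimit.Theorems.GapForcesFarMerging.Negative

open Literature.Probability.LatticeModels
open Summit.CriticalPhenomena.Ising3DConformalLimit.Theses.EnergyNotSigmaSquared

/-! ## Lattice vocabulary of the line `rp-unpinch-single-passage` (copied verbatim from the skeleton) -/

/-- The far point `xR m = 2m·e₁`. [folklore] -/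
def xR (m : ℕ) : Site 3 := Pi.single 0 (2 * (m : ℤ))

/-- Upper far target `up m = (2m, m, 0)`. [folklore] -/
def up (m : ℕ) : Site 3 := xR m + Pi.single 1 (m : ℤ)

/-- Lower far target `dn m = (2m, -m, 0)`. [folklore] -/
def dn (m : ℕ) : Site 3 := xR m - Pi.single 1 (m : ℤ)

/-- The site mirror `x₀ ↦ 2m - x₀`. [folklore] -/
def mirror (m : ℕ) (y : Site 3) : Site 3 := y - Pi.single 0 (2 * (y 0 - m))

/-- The opened upper nail `s·e₂`. [folklore] -/
def src (s : ℕ) : Site 3 := Pi.single 1 (s : ℤ)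

/-- The thin witness shapes `Th a = (0, (2a,-a,0), e₂, (2a,a,0))`. [folklore] -/
def Th (a : ℕ) : Fin 4 → Site 3 :=
  ![0, Pi.single 0 (2 * (a : ℤ)) - Pi.single 1 (a : ℤ), e₂, Pi.single 0 (2 * (a : ℤ)) + Pi.single 1 (a : ℤ)]

/-! ## Abstract shapes of the five stub statements (model forgotten) -/

section shapes
variable (S : Site 3 → Site 3 → ℝ) (T : Site 3 → ℝ) (F : (Fin 4 → Site 3) → ℝ)

/-- Abstract truncated pair–pair correlation `F(a,b,c,d) - S(a,b)S(c,d)`. [folklore] -/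
def pairCovS (a b c d : Site 3) : ℝ := F ![a, b, c, d] - S a b * S c d

/-- Abstract single-pinch truncation `T(b; m)`. [folklore] -/
def TS (b : Site 3) (m : ℕ) : ℝ := pairCovS S F 0 b (up m) (dn m)

/-- Abstract parallel normalisation `S(0, dn m) S(b, up m)`. [folklore] -/
def NparS (b : Site 3) (m : ℕ) : ℝ := S 0 (dn m) * S b (up m)

/-- Abstract avoidance functional `𝒜(b; m) = T(b;m)/Npar(b;m)`. [folklore] -/
def avoidS (b : Site 3) (m : ℕ) : ℝ := TS S F b m / NparS S b m

/-- Shape of `RPUnpinch` (all mirrors, all far-side targets). [folklore] -/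
def RPUnpinchShape : Prop :=
  ∀ (m : ℕ) (y z : Site 3), (m : ℤ) ≤ y 0 → (m : ℤ) ≤ z 0 →
    pairCovS S F 0 e₂ y z ^ 2 ≤
      pairCovS S F 0 e₂ (xR m) (xR m + e₂) * pairCovS S F (mirror m y) (mirror m z) y z

/-- The ISOSCELES instances of `RPUnpinch` (targets `up m`, `dn m`, mirror images `±m e₂`) — the
only instances consumed by the skeleton's proved glue `gapGivesSinglePinch`. [folklore] -/
def RPUnpinchIsoShape : Prop :=
  ∀ m : ℕ, 1 ≤ m →
    pairCovS S F 0 e₂ (up m) (dn m) ^ 2 ≤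
      pairCovS S F 0 e₂ (xR m) (xR m + e₂) *
        pairCovS S F (Pi.single 1 (m : ℤ)) (Pi.single 1 (-(m : ℤ))) (up m) (dn m)

/-- Shape of `UnpinchedEnvelope`. [folklore] -/
def UnpinchedEnvelopeShape : Prop :=
  ∀ m : ℕ, 1 ≤ m →
    0 ≤ pairCovS S F (Pi.single 1 (m : ℤ)) (Pi.single 1 (-(m : ℤ))) (up m) (dn m) ∧
      pairCovS S F (Pi.single 1 (m : ℤ)) (Pi.single 1 (-(m : ℤ))) (up m) (dn m) ≤ 2 * T (xR m) ^ 2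

/-- Shape of `SinglePinchLaw`. [folklore] -/
def SinglePinchLawShape : Prop :=
  ∃ κ' C : ℝ, 0 < κ' ∧ ∀ m : ℕ, 1 ≤ m →
    pairCovS S F 0 e₂ (up m) (dn m) ≤ C * (2 * (m : ℝ)) ^ (-κ') * T (xR m) ^ 2

/-- Shape of `SinglePinchPositive`. [folklore] -/
def SinglePinchPositiveShape : Prop := ∀ m : ℕ, 1 ≤ m → 0 < TS S F e₂ m

/-- Shape of `QuasiMultiplicative` (the hardest stub). [folklore] -/
def QuasiMultiplicativeShape : Prop :=
  ∃ c : ℝ, 0 < c ∧ ∀ s m : ℕ, 1 ≤ s → 2 * s ≤ m →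
    c * avoidS S F e₂ s * avoidS S F (src s) m ≤ avoidS S F e₂ m

end shapes

/-! ## Family A′: `θ_{A′} = θ_A · (1 − min(1, sep)·Pmin)` -/

/-- `θ_{A′}`: family A's merging probability lowered by the factor `1 − min(1,sep)·Pmin` (equal to
`1` at coincidences). [folklore] -/
def θA' (y : Fin 4 → Site 3) : ℝ := θA y * (1 - min 1 (sep y) * pmin S₀ y)

/-- Family A′. [folklore] -/
def FA' : (Fin 4 → Site 3) → ℝ := Fθ θA'

/-- `Pmin ≤ 1`. [folklore] -/
theorem pmin_le_one (y : Fin 4 → Site 3) : pmin S₀ y ≤ 1 :=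
  (pmin_le_P₁ y).trans (by
    unfold P₁
    exact mul_le_one₀ (S₀_le_one _ _) (S₀_nonneg _ _) (S₀_le_one _ _))

/-- `0 ≤ min(1,sep)·Pmin ≤ 1`. [folklore] -/
theorem corr_mem (y : Fin 4 → Site 3) :
    0 ≤ min 1 (sep y) * pmin S₀ y ∧ min 1 (sep y) * pmin S₀ y ≤ 1 := by
  have h1 : 0 ≤ min 1 (sep y) := le_min zero_le_one (sep_nonneg y)
  have h2 : min 1 (sep y) ≤ 1 := min_le_left _ _
  exact ⟨mul_nonneg h1 (pmin_nonneg y), mul_le_one₀ h2 (pmin_nonneg y) (pmin_le_one y)⟩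

/-- `0 ≤ θ_{A′} ≤ θ_A`. [folklore] -/
theorem θA'_nonneg (y : Fin 4 → Site 3) : 0 ≤ θA' y := by
  unfold θA'
  exact mul_nonneg (θA_nonneg y) (by linarith [(corr_mem y).2])

/-- `θ_{A′} ≤ θ_A`. [folklore] -/
theorem θA'_le_θA (y : Fin 4 → Site 3) : θA' y ≤ θA y := by
  unfold θA'
  exact mul_le_of_le_one_right (θA_nonneg y) (by linarith [(corr_mem y).1])

/-- `θ_{A′}` is admissible. [folklore] -/
theorem thetaHyp_A' : ThetaHyp θA' where
  nonneg := θA'_nonneg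
  le_one y := (θA'_le_θA y).trans (θA_le_one y)
  swap01 y := by unfold θA'; rw [thetaHyp_A.swap01, sep_comp_perm, pmin_swap01 S₀_symm]
  swap12 y := by unfold θA'; rw [thetaHyp_A.swap12, sep_comp_perm, pmin_swap12 S₀_symm]
  swap23 y := by unfold θA'; rw [thetaHyp_A.swap23, sep_comp_perm, pmin_swap23 S₀_symm]
  transl y v := by unfold θA'; rw [thetaHyp_A.transl, sep_transl, pmin_transl]
  coincide a x z := by unfold θA'; rw [thetaHyp_A.coincide, sep_coincide]; simp

/-- Family A′ has the soft package. [folklore] -/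
theorem softPackage_A' : SoftPackage S₀ T₀ FA' := softPackage_Fθ_core thetaHyp_A' not_summable_S₀_sq

/-- Family A′ has no far merging (`θ_{A′} ≤ θ_A ≤ 1/sep` in the bulk). [folklore] -/
theorem not_farMergingShape_A' : ¬ FarMergingShape S₀ FA' :=
  not_farMergingShape_of_decay θA'_nonneg fun y hy =>
    (θA'_le_θA y).trans (by unfold θA; rw [max_eq_right (by linarith)])

/-- GAP shapes are stable under adding `C'‖x‖⁻¹T(x)²` on the adjacent stratum. [folklore] -/
theorem gapShape_of_le_add {S : Site 3 → Site 3 → ℝ} {T : Site 3 → ℝ}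
    {F F' : (Fin 4 → Site 3) → ℝ} (h : GapShape S T F) (C' : ℝ)
    (hF' : ∀ x : Site 3, x ≠ 0 →
      F' ![0, e₂, x, x + e₂] ≤ F ![0, e₂, x, x + e₂] + C' * (‖x‖ : ℝ) ^ (-(1 : ℝ)) * T x ^ 2) :
    GapShape S T F' := by
  obtain ⟨κ, C, hκ, hC⟩ := h
  refine ⟨min κ 1, max C 0 + max C' 0, lt_min hκ one_pos, fun x hx => ?_⟩
  have h1 := one_le_norm_of_ne_zero hx
  have hT : 0 ≤ T x ^ 2 := sq_nonneg _
  have hk : (‖x‖ : ℝ) ^ (-κ) ≤ ‖x‖ ^ (-(min κ 1)) :=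
    Real.rpow_le_rpow_of_exponent_le h1 (by simp)
  have h1' : (‖x‖ : ℝ) ^ (-(1 : ℝ)) ≤ ‖x‖ ^ (-(min κ 1)) :=
    Real.rpow_le_rpow_of_exponent_le h1 (by simp)
  have hp : 0 ≤ (‖x‖ : ℝ) ^ (-(min κ 1)) := Real.rpow_nonneg (norm_nonneg _) _
  calc F' ![0, e₂, x, x + e₂] - S 0 e₂ * S x (x + e₂)
      ≤ (F ![0, e₂, x, x + e₂] - S 0 e₂ * S x (x + e₂)) + C' * (‖x‖ : ℝ) ^ (-(1 : ℝ)) * T x ^ 2 := by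
        linarith [hF' x hx]
    _ ≤ C * (‖x‖ : ℝ) ^ (-κ) * T x ^ 2 + C' * (‖x‖ : ℝ) ^ (-(1 : ℝ)) * T x ^ 2 := by
        linarith [hC x hx]
    _ ≤ max C 0 * (‖x‖ : ℝ) ^ (-(min κ 1)) * T x ^ 2 + max C' 0 * (‖x‖ : ℝ) ^ (-(min κ 1)) * T x ^ 2 := by
        have hA : C * (‖x‖ : ℝ) ^ (-κ) ≤ max C 0 * (‖x‖ : ℝ) ^ (-(min κ 1)) :=
          calc C * (‖x‖ : ℝ) ^ (-κ) ≤ max C 0 * (‖x‖ : ℝ) ^ (-κ) :=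
                mul_le_mul_of_nonneg_right (le_max_left _ _) (Real.rpow_nonneg (norm_nonneg _) _)
            _ ≤ max C 0 * (‖x‖ : ℝ) ^ (-(min κ 1)) := mul_le_mul_of_nonneg_left hk (le_max_right _ _)
        have hB : C' * (‖x‖ : ℝ) ^ (-(1:ℝ)) ≤ max C' 0 * (‖x‖ : ℝ) ^ (-(min κ 1)) :=
          calc C' * (‖x‖ : ℝ) ^ (-(1:ℝ)) ≤ max C' 0 * (‖x‖ : ℝ) ^ (-(1:ℝ)) :=
                mul_le_mul_of_nonneg_right (le_max_left _ _) (Real.rpow_nonneg (norm_nonneg _) _)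
            _ ≤ max C' 0 * (‖x‖ : ℝ) ^ (-(min κ 1)) := mul_le_mul_of_nonneg_left h1' (le_max_right _ _)
        exact add_le_add (mul_le_mul_of_nonneg_right hA hT) (mul_le_mul_of_nonneg_right hB hT)
    _ = (max C 0 + max C' 0) * (‖x‖ : ℝ) ^ (-(min κ 1)) * T x ^ 2 := by ring

/-- `g(x)² ≤ ‖x‖⁻¹` for `x ≠ 0`. [folklore] -/
theorem g_sq_le_inv_norm {x : Site 3} (hx : x ≠ 0) : g x * g x ≤ (‖x‖ : ℝ) ^ (-(1 : ℝ)) := by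
  rw [Real.rpow_neg_one]
  have h1 := one_le_norm_of_ne_zero hx
  have hg1 : g x ≤ ‖x‖⁻¹ := by
    rw [g_eq]; exact inv_anti₀ (by linarith) (by linarith)
  calc g x * g x ≤ 1 * ‖x‖⁻¹ := mul_le_mul (g_le_one x) hg1 (g_pos x).le zero_le_one
    _ = ‖x‖⁻¹ := one_mul _

/-- **Family A′ satisfies the GAP shape** (A's truncation plus `2·Pmin·(θ_A − θ_{A′}) ≤ 2Pmin² ≤ 2‖x‖⁻¹g(x)²`). [folklore] -/
theorem gapShape_A' : GapShape S₀ T₀ FA' := by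
  refine gapShape_of_le_add gapShape_A 2 fun x hx => ?_
  have hA := adjacent_trunc_eq θA x
  have hA' := adjacent_trunc_eq θA' x
  have hdiff : FA' ![0, e₂, x, x + e₂] = FA ![0, e₂, x, x + e₂] +
      2 * pmin S₀ ![0, e₂, x, x + e₂] * (θA ![0, e₂, x, x + e₂] - θA' ![0, e₂, x, x + e₂]) := by
    rw [FA, FA'] at *; linarith
  rw [hdiff]
  have hm0 := pmin_nonneg ![0, e₂, x, x + e₂]
  have hθ : θA ![0, e₂, x, x + e₂] - θA' ![0, e₂, x, x + e₂] ≤ pmin S₀ ![0, e₂, x, x + e₂] := by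
    unfold θA'
    have hc := corr_mem ![0, e₂, x, x + e₂]
    have h0 := θA_nonneg ![0, e₂, x, x + e₂]
    have h1 := θA_le_one ![0, e₂, x, x + e₂]
    have hmin : min 1 (sep ![0, e₂, x, x + e₂]) ≤ 1 := min_le_left _ _
    have hmin0 : 0 ≤ min 1 (sep ![0, e₂, x, x + e₂]) := le_min zero_le_one (sep_nonneg _)
    nlinarith [mul_le_mul hmin le_rfl hm0 zero_le_one, mul_nonneg hmin0 hm0]
  have hpg : pmin S₀ ![0, e₂, x, x + e₂] ≤ g x * g x := by
    rw [pmin_adjacent_eq]; exact (min_le_left _ _).trans (min_le_right _ _)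
  have hT : T₀ x = g x := by simp [T₀, S₀]
  rw [hT]
  have hg2 := g_sq_le_inv_norm hx
  nlinarith [mul_le_mul hθ hpg hm0 hm0, g_pos x]



/-! ### The thin shapes -/

/-- Dilating `Th a` by `s` gives the opened-pinch configuration `(0, dn (as), src s, up (as))`. [folklore] -/
theorem smul_Th (a s : ℕ) :
    (fun i => (s : ℤ) • Th a i) = ![0, dn (a * s), src s, up (a * s)] := by
  funext i
  fin_cases i <;> (ext j; fin_cases j <;> simp [Th, dn, up, xR, src] <;> ring)

/-- Pointwise form of `smul_Th`. [folklore] -/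
theorem smul_Th_pts (a L : ℕ) :
    (L : ℤ) • Th a 0 = (0 : Site 3) ∧ (L : ℤ) • Th a 1 = dn (a * L) ∧ (L : ℤ) • Th a 2 = src L ∧
      (L : ℤ) • Th a 3 = up (a * L) := by
  have h := smul_Th a L
  exact ⟨by simpa using congrFun h 0, by simpa using congrFun h 1, by simpa using congrFun h 2,
    by simpa using congrFun h 3⟩

/-- The thin shapes are injective quadruples. [folklore] -/
theorem Th_injective {a : ℕ} (ha : 1 ≤ a) : Function.Injective (Th a) := by
  have ha0 : (a : ℤ) ≠ 0 := by exact_mod_cast Nat.one_le_iff_ne_zero.1 ha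
  unfold Th
  refine injective_vec4 ?_ ?_ ?_ ?_ ?_ ?_
  · intro h; have := congrFun h 0; simp at this; omega
  · intro h; have := congrFun h 1; simp at this
  · intro h; have := congrFun h 0; simp at this; omega
  · intro h; have := congrFun h 0; simp at this; omega
  · intro h; have := congrFun h 1; simp at this; omega
  · intro h; have := congrFun h 0; simp at this; omega


/-! ## The Ising instances: the shapes ARE the registered stubs, and stub 5 holds -/

section ising

/-- `SinglePinchLawShape` at the critical correlators is the skeleton's `SinglePinchLaw`, verbatim. [folklore] -/
theorem singlePinchLawShape_criticalCorr_iff :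
    SinglePinchLawShape cc2 (criticalTwoPoint 3) (criticalCorr 3 4) ↔
      ∃ κ' C : ℝ, 0 < κ' ∧ ∀ m : ℕ, 1 ≤ m →
        criticalCorr 3 4 ![0, e₂, up m, dn m] - criticalCorr 3 2 ![0, e₂] * criticalCorr 3 2 ![up m, dn m] ≤
          C * (2 * (m : ℝ)) ^ (-κ') * criticalTwoPoint 3 (xR m) ^ 2 :=
  Iff.rfl

/-- `SinglePinchPositiveShape` at the critical correlators is the skeleton's `SinglePinchPositive`. [folklore] -/
theorem singlePinchPositiveShape_criticalCorr_iff :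
    SinglePinchPositiveShape cc2 (criticalCorr 3 4) ↔
      ∀ m : ℕ, 1 ≤ m →
        0 < criticalCorr 3 4 ![0, e₂, up m, dn m] - criticalCorr 3 2 ![0, e₂] * criticalCorr 3 2 ![up m, dn m] :=
  Iff.rfl

/-- `QuasiMultiplicativeShape` at the critical correlators is the skeleton's `QuasiMultiplicative`. [folklore] -/
theorem quasiMultiplicativeShape_criticalCorr_iff :
    QuasiMultiplicativeShape cc2 (criticalCorr 3 4) ↔
      ∃ c : ℝ, 0 < c ∧ ∀ s m : ℕ, 1 ≤ s → 2 * s ≤ m →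
        c * ((criticalCorr 3 4 ![0, e₂, up s, dn s] - criticalCorr 3 2 ![0, e₂] * criticalCorr 3 2 ![up s, dn s]) /
              (criticalCorr 3 2 ![0, dn s] * criticalCorr 3 2 ![e₂, up s])) *
            ((criticalCorr 3 4 ![0, src s, up m, dn m] -
                criticalCorr 3 2 ![0, src s] * criticalCorr 3 2 ![up m, dn m]) /
              (criticalCorr 3 2 ![0, dn m] * criticalCorr 3 2 ![src s, up m])) ≤
          (criticalCorr 3 4 ![0, e₂, up m, dn m] - criticalCorr 3 2 ![0, e₂] * criticalCorr 3 2 ![up m, dn m]) /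
            (criticalCorr 3 2 ![0, dn m] * criticalCorr 3 2 ![e₂, up m]) :=
  Iff.rfl

/-- `RPUnpinchShape` at the critical correlators is the skeleton's `RPUnpinch`. [folklore] -/
theorem rpUnpinchShape_criticalCorr_iff :
    RPUnpinchShape cc2 (criticalCorr 3 4) ↔
      ∀ (m : ℕ) (y z : Site 3), (m : ℤ) ≤ y 0 → (m : ℤ) ≤ z 0 →
        (criticalCorr 3 4 ![0, e₂, y, z] - criticalCorr 3 2 ![0, e₂] * criticalCorr 3 2 ![y, z]) ^ 2 ≤
          (criticalCorr 3 4 ![0, e₂, xR m, xR m + e₂] -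
              criticalCorr 3 2 ![0, e₂] * criticalCorr 3 2 ![xR m, xR m + e₂]) *
            (criticalCorr 3 4 ![mirror m y, mirror m z, y, z] -
              criticalCorr 3 2 ![mirror m y, mirror m z] * criticalCorr 3 2 ![y, z]) :=
  Iff.rfl

/-- `UnpinchedEnvelopeShape` at the critical correlators is the skeleton's `UnpinchedEnvelope`. [folklore] -/
theorem unpinchedEnvelopeShape_criticalCorr_iff :
    UnpinchedEnvelopeShape cc2 (criticalTwoPoint 3) (criticalCorr 3 4) ↔
      ∀ m : ℕ, 1 ≤ m →
        0 ≤ criticalCorr 3 4 ![Pi.single 1 (m : ℤ), Pi.single 1 (-(m : ℤ)), up m, dn m] -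
            criticalCorr 3 2 ![Pi.single 1 (m : ℤ), Pi.single 1 (-(m : ℤ))] * criticalCorr 3 2 ![up m, dn m] ∧
        criticalCorr 3 4 ![Pi.single 1 (m : ℤ), Pi.single 1 (-(m : ℤ)), up m, dn m] -
            criticalCorr 3 2 ![Pi.single 1 (m : ℤ), Pi.single 1 (-(m : ℤ))] * criticalCorr 3 2 ![up m, dn m] ≤
          2 * criticalTwoPoint 3 (xR m) ^ 2 :=
  Iff.rfl

end ising

end Summit.CriticalPhenomena.Ising3DConformalLimit.Theorems.GapForcesFarMerging.Negative

end
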